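import Summits.RiemannHypothesis.RiemannHypothesis.Theorems.PfPersistenceDialLemma
import HarnessLib

/-!
# PF persistence — the MIDPOINT LEMMA (two-sided dial lemma) and leaf G1.11 (pub-rhpf, cand-6 gen 2)

**HONEST FRAMING. MECHANISM / RIGIDITY campaign; no RH claims.**  Companion of the barrier-typer's
`PfPersistenceAdmissibleClass.lean` / `PfPersistenceLocalityBarrier.lean` (objects `Window`, `Datum`,
`Weights`, `evenBlock`, `dial`, `datumOf`, `zetaDatum`, `dialSpace`, `WindowPositive`,
`DetectablyNegative`) and of the barrier-prover's `PfPersistenceDialLemma.lean`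
(`dialStable_meets_negative` = leaf L1 × R0: single-window predicates STABLE along a dial at
resolution `T ≥ 2ε₁/|β|` are unsound per window).  This file removes the stability hypothesis for
the class of single-window criteria whose REJECTION set is convex in the block:

* §1 **Affinity of the datum in the weight table (PROVED)**: `WP_linearCombo`,
  `evenBlock_convexCombo` (`evenBlock (s • w₁ + t • w₂) = s • evenBlock w₁ + t • evenBlock w₂`
  when `s + t = 1`, at EVERY window — no prime-range case split), `dial_convexCombo` (a weight table
  is an explicit convex combination of its two `p`-dials `K₁ < 1 < K₂`).
* §2 **MIDPOINT LEMMA (PROVED)** `twoSidedDial_meets_negative`: if a predicate `P` of the block at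
  ONE window has a CONVEX REJECTION SET `{M | ¬ P M}` and holds at the block of `w`, and the two
  dials `dial p K₁ w`, `dial p K₂ w` (`K₁ < 1 < K₂`, any sizes) are BOTH not window-positive at that
  window, then `P` holds at a dial whose block is not window-positive: `P` is UNSOUND for positivity
  at that window.  No margin, Lipschitz modulus, resolution or Davis–Kahan input (contrast
  `dialStable_meets_negative`, whose `hstab` is exactly what concrete functionals cannot certify
  below `ε₁`-scale).  Datum form for `ζ`: `twoSidedDial_criterion_meets_dialNegatives`.
* §3 **The class (PROVED)**: every AFFINE one-sided statistic `0 ≤ φ(M) + c` (`φ` ANY real-linear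
  functional of the block — `Tr(A M)` for any fixed `A`, position-basis or spectral, sector sums,
  smoothed one-sided explicit-formula sums; CASE-DAG leaf G1.11) has convex rejection set
  (`convex_not_affineNonneg`); so does any finite DISJUNCTION of such (`convex_not_or`).  The sound
  criterion sits on the other side: `WindowPositive` itself has convex ACCEPTANCE set
  (`convex_windowPositive`) — the lemma is silent there, as it must be.

DATA that discharges the two negativity hypotheses on the served bank (harness loader rows of
record, `run/shared/lean/pub/pub-rhpf/pub-rhpf-cand-6/out/g111_midpoint_cert.md`): at 43 of the 44
`ζ` windows carrying `λ`-pert dials (every dial window with `a ≥ 0.45`; `N = N(a) ∈ [100, 360]`)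
the pair `(q, K₁, K₂) = (2, 0.99 or 0.9 or 0.5, 1.01)` has `ε₁^even < 0` on both sides while
`ε₁^even(ζ) > 0` (engine arb); e.g. `(a, N) = (1, 100)`: `ε₁^even(ζ) = 6.50e-30`,
`ε₁^even(2, 0.99) = −6.89e-3`, `ε₁^even(2, 1.01) = −6.92e-3`.  Independently CERTIFIED (engine-A Arb
balls) for the `prime_dial` `p = 2` family on 24/24 windows `a ∈ {0.50, …, 1.65}`
(`pub-rhpf-pf/FK-DIAL-CERT.md`; CLOSED-CLASSES row B-L1×R0 INSTANCES).  Those negativity facts are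
HYPOTHESES (`h₁`, `h₂`) below, never asserted.  No RH-bearing statement occurs in this file.
-/

set_option linter.dupNamespace false

noncomputable section

open Matrix

namespace Summit.RiemannHypothesis.RiemannHypothesis.Theorems.PfPersistence

/-! ## §1 The datum is affine in the weight table (PROVED) -/

/-- PROVED: the prime part is LINEAR in the weight table. [folklore] -/
theorem WP_linearCombo (L : ℝ) (w₁ w₂ : Weights) (s t : ℝ) (Θ : ℝ → ℝ) :
    WP L (s • w₁ + t • w₂) Θ = s * WP L w₁ Θ + t * WP L w₂ Θ := by
  simp only [WP, Pi.add_apply, Pi.smul_apply, smul_eq_mul, add_mul, Finset.sum_add_distrib,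
    mul_assoc, ← Finset.mul_sum]
  ring

/-- PROVED: the even block is AFFINE in the weight table — at EVERY window (no prime-range case
split): `evenBlock (s • w₁ + t • w₂) = s • evenBlock w₁ + t • evenBlock w₂` for `s + t = 1`. [folklore] -/
theorem evenBlock_convexCombo (w₁ w₂ : Weights) {s t : ℝ} (hst : s + t = 1) (win : Window) :
    evenBlock (s • w₁ + t • w₂) win = s • evenBlock w₁ win + t • evenBlock w₂ win := by
  ext n m
  simp only [evenBlock, weil, Matrix.add_apply, Matrix.smul_apply, smul_eq_mul, WP_linearCombo]
  obtain rfl : t = 1 - s := by linarith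
  ring

/-- PROVED: a weight table is the explicit CONVEX COMBINATION of its two `p`-dials by factors
`K₁ ≠ K₂`: `w = ((K₂−1)/(K₂−K₁)) • dial p K₁ w + ((1−K₁)/(K₂−K₁)) • dial p K₂ w` (coefficients
`≥ 0` and summing to `1` when `K₁ < 1 < K₂`). [folklore] -/
theorem dial_convexCombo (p : ℕ) (w : Weights) {K₁ K₂ : ℝ} (hK : K₁ ≠ K₂) :
    ((K₂ - 1) / (K₂ - K₁)) • dial p K₁ w + ((1 - K₁) / (K₂ - K₁)) • dial p K₂ w = w := by
  have hs : K₂ - K₁ ≠ 0 := sub_ne_zero.mpr (Ne.symm hK)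
  funext q
  simp only [Pi.add_apply, Pi.smul_apply, smul_eq_mul, dial]
  split_ifs
  · field_simp
    ring
  · field_simp
    ring

/-! ## §2 The MIDPOINT LEMMA: two-sided negative dials defeat every convex-rejection criterion (PROVED) -/

/-- **PROVED (MIDPOINT LEMMA / two-sided dial lemma; per-window unsoundness with NO stability
modulus).**  Let `P` be a predicate of the block at ONE window whose REJECTION set `{M | ¬ P M}` is
convex, holding at the block of the weight table `w`.  If the two `p`-dials `K₁ < 1 < K₂` of `w`
(any sizes) are BOTH not window-positive at that window, then `P` holds at the block of some dial
`dial p K w` which is not window-positive: `P` does not certify positivity at that window.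
(Which side: for an affine statistic `m ∓ δβ` the sign of `β` decides; one side always passes.)
Contrast `dialStable_meets_negative`: no `hstab`, no `2ε/|β| ≤ T`. [folklore] -/
theorem twoSidedDial_meets_negative (p : ℕ) (win : Window) (w : Weights)
    {P : Matrix (Fin (win.N + 1)) (Fin (win.N + 1)) ℝ → Prop} (hconv : Convex ℝ {M | ¬ P M})
    {K₁ K₂ : ℝ} (hK₁ : K₁ < 1) (hK₂ : 1 < K₂)
    (h₁ : ¬ WindowPositive (evenBlock (dial p K₁ w) win))
    (h₂ : ¬ WindowPositive (evenBlock (dial p K₂ w) win)) (hw : P (evenBlock w win)) :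
    ∃ K : ℝ, P (evenBlock (dial p K w) win) ∧ ¬ WindowPositive (evenBlock (dial p K w) win) := by
  by_contra h
  have n₁ : evenBlock (dial p K₁ w) win ∈ {M | ¬ P M} := fun hP => h ⟨K₁, hP, h₁⟩
  have n₂ : evenBlock (dial p K₂ w) win ∈ {M | ¬ P M} := fun hP => h ⟨K₂, hP, h₂⟩
  have hD : 0 < K₂ - K₁ := by linarith
  have hs : 0 ≤ (K₂ - 1) / (K₂ - K₁) := div_nonneg (by linarith) hD.le
  have ht : 0 ≤ (1 - K₁) / (K₂ - K₁) := div_nonneg (by linarith) hD.le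
  have hst : (K₂ - 1) / (K₂ - K₁) + (1 - K₁) / (K₂ - K₁) = 1 := by
    rw [← add_div, div_eq_one_iff_eq hD.ne']
    ring
  have key := hconv n₁ n₂ hs ht hst
  rw [← evenBlock_convexCombo _ _ hst, dial_convexCombo p w (by linarith : K₁ ≠ K₂)] at key
  exact key hw

/-- **PROVED (datum form at `ζ`).**  A single-window criterion `{d | P (d win)}` with convex
rejection set that accepts `ζ`, at a window where two `p`-dials of `ζ` on opposite sides are not
window-positive, contains a DETECTABLY NEGATIVE member of the arithmetic dial space: it does not
separate `ζ` from the dial-space negatives at that window.  The two negativity hypotheses are DATA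
on the served bank (module docstring), entered here as hypotheses. [folklore] -/
theorem twoSidedDial_criterion_meets_dialNegatives (p : ℕ) (win : Window)
    {P : Matrix (Fin (win.N + 1)) (Fin (win.N + 1)) ℝ → Prop} (hconv : Convex ℝ {M | ¬ P M})
    {K₁ K₂ : ℝ} (hK₁ : K₁ < 1) (hK₂ : 1 < K₂)
    (h₁ : ¬ WindowPositive (datumOf (dial p K₁ zetaWeights) win))
    (h₂ : ¬ WindowPositive (datumOf (dial p K₂ zetaWeights) win)) (hζ : P (zetaDatum win)) :
    ∃ d ∈ dialSpace, d ∈ {d : Datum | P (d win)} ∧ DetectablyNegative d := by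
  obtain ⟨K, hPK, hneg⟩ :=
    twoSidedDial_meets_negative p win zetaWeights hconv hK₁ hK₂ h₁ h₂ hζ
  refine ⟨datumOf (dial p K zetaWeights), ⟨_, rfl⟩, hPK, win, ?_⟩
  simpa [WindowPositive, datumOf, not_forall, not_le] using hneg

/-- **PROVED (abstract form, any real vector space).**  A set with convex complement containing a
point of a segment contains an endpoint — the one-line heart of the lemma, recorded for criteria on
other data spaces (pairs of sector blocks, continuum `ExplicitDatum` records) where the dial acts
affinely. [folklore] -/
theorem mem_or_mem_of_convex_compl {V : Type*} [AddCommGroup V] [Module ℝ V] {K : Set V}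
    (hK : Convex ℝ Kᶜ) {x y : V} {s t : ℝ} (hs : 0 ≤ s) (ht : 0 ≤ t) (hst : s + t = 1)
    (hz : s • x + t • y ∈ K) : x ∈ K ∨ y ∈ K := by
  by_contra h
  exact hK (fun hx => h (Or.inl hx)) (fun hy => h (Or.inr hy)) hs ht hst hz

/-! ## §3 The class: affine one-sided statistics and their disjunctions reject convexly (PROVED) -/

/-- PROVED: an AFFINE one-sided statistic `0 ≤ φ(M) + c` (`φ` any real-linear functional of the
block: `Tr(A M)` for a fixed `A` in any basis, sector traces, smoothed one-sided explicit-formula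
sums — CASE-DAG leaf G1.11) has a CONVEX rejection set. [folklore] -/
theorem convex_not_affineNonneg {V : Type*} [AddCommGroup V] [Module ℝ V] (φ : V →ₗ[ℝ] ℝ) (c : ℝ) :
    Convex ℝ {M : V | ¬ (0 ≤ φ M + c)} := by
  have h : {M : V | ¬ (0 ≤ φ M + c)} = φ ⁻¹' Set.Iio (-c) := by
    ext M
    simp only [Set.mem_setOf_eq, Set.mem_preimage, Set.mem_Iio, not_le]
    constructor <;> intro hM <;> linarith
  rw [h]
  exact (convex_Iio (-c)).linear_preimage φ

/-- PROVED: G1.11 instance of the midpoint lemma — the affine statistic `0 ≤ Tr(A M) + c` (ANY fixed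
`A`, indefinite or not, any offset `c`) accepting `w`'s block at a window with two-sided
non-positive dials accepts a non-positive dial block. [folklore] -/
theorem affineStat_meets_negative (p : ℕ) (win : Window) (w : Weights)
    (A : Matrix (Fin (win.N + 1)) (Fin (win.N + 1)) ℝ) (c : ℝ)
    {K₁ K₂ : ℝ} (hK₁ : K₁ < 1) (hK₂ : 1 < K₂)
    (h₁ : ¬ WindowPositive (evenBlock (dial p K₁ w) win))
    (h₂ : ¬ WindowPositive (evenBlock (dial p K₂ w) win))
    (hw : 0 ≤ Matrix.trace (A * evenBlock w win) + c) :
    ∃ K : ℝ, 0 ≤ Matrix.trace (A * evenBlock (dial p K w) win) + c ∧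
      ¬ WindowPositive (evenBlock (dial p K w) win) := by
  have hconv : Convex ℝ {M : Matrix (Fin (win.N + 1)) (Fin (win.N + 1)) ℝ |
      ¬ (0 ≤ Matrix.trace (A * M) + c)} := by
    simpa only [LinearMap.comp_apply, LinearMap.mulLeft_apply, Matrix.traceLinearMap_apply] using
      convex_not_affineNonneg
        ((Matrix.traceLinearMap (Fin (win.N + 1)) ℝ ℝ).comp (LinearMap.mulLeft ℝ A)) c
  exact twoSidedDial_meets_negative p win w (P := fun M => 0 ≤ Matrix.trace (A * M) + c)
    hconv hK₁ hK₂ h₁ h₂ hw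

/-- PROVED: a finite DISJUNCTION of convex-rejection criteria rejects convexly (intersection). [folklore] -/
theorem convex_not_or {V : Type*} [AddCommGroup V] [Module ℝ V] {P₁ P₂ : V → Prop}
    (h₁ : Convex ℝ {M | ¬ P₁ M}) (h₂ : Convex ℝ {M | ¬ P₂ M}) :
    Convex ℝ {M | ¬ (P₁ M ∨ P₂ M)} := by
  have h : {M | ¬ (P₁ M ∨ P₂ M)} = {M | ¬ P₁ M} ∩ {M | ¬ P₂ M} := by
    ext M
    simp only [Set.mem_setOf_eq, Set.mem_inter_iff, not_or]
  rw [h]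
  exact h₁.inter h₂

/-- PROVED (the other side): window-positivity itself has a convex ACCEPTANCE set — the midpoint
lemma says nothing about it (nor about `min` of affine tests / PSD on a subspace / concave Ky Fan
bottom sums), consistent with `ε₁ ≥ 0` being the sound criterion. [folklore] -/
theorem convex_windowPositive (n : ℕ) :
    Convex ℝ {M : Matrix (Fin n) (Fin n) ℝ | WindowPositive M} := by
  intro M₁ h₁ M₂ h₂ a b ha hb _
  rw [Set.mem_setOf_eq] at h₁ h₂ ⊢
  intro v
  rw [Matrix.add_mulVec, Matrix.smul_mulVec, Matrix.smul_mulVec, dotProduct_add, dotProduct_smul,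
    dotProduct_smul, smul_eq_mul, smul_eq_mul]
  exact add_nonneg (mul_nonneg ha (h₁ v)) (mul_nonneg hb (h₂ v))

end Summit.RiemannHypothesis.RiemannHypothesis.Theorems.PfPersistence

end
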